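import Literature.Topology.FourManifolds.CompactlySupportedDiffeo
import Literature.Topology.FourManifolds.InverseFunctionTheorem
import Mathlib.Analysis.InnerProductSpace.Calculus
import Mathlib.Analysis.SpecialFunctions.Log.Basic
import HarnessLib

/-!
# Fibrewise families of compactly supported straightenings

Generic analytic infrastructure (a real normed space `E`, finite-dimensional where needed) for
comparing two tubular neighbourhoods of a circle that differ by a fibrewise change of framing
close to the identity (Gompf–Stipsicz, *4-Manifolds and Kirby Calculus*, §5.2; Hirsch,
*Differential Topology*, Ch. 8 §3, proof of Thm 3.1: near-identity maps agree near `0` with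
compactly supported diffeomorphisms, "by inserting a bump function"):

* `Literature.Topology.FourManifolds.isLocalDiffeomorph_fibrewise`, `Literature.Topology.FourManifolds.fibrewiseDiffeomorph` — **fibrewise families of
  diffeomorphisms are diffeomorphisms of the product**: if `F : N → E → E` is jointly `C^∞` and
  every `F x` is a bijective local diffeomorphism of `E`, then `(x, v) ↦ (x, F x v)` is a
  diffeomorphism of `N × E` (the differential in charts is a shear; inverse function theorem on
  manifolds, `InverseFunctionTheorem.lean`);
* `Literature.straightenFun ρ L`, `Literature.Topology.FourManifolds.straightenDiffeo` — the **near-identity straightening**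
  `y ↦ y + χ(y/ρ) (L y - y)` of a continuous linear `L` with `‖L - 1‖` small: a diffeomorphism
  of `E` equal to `L` on `B̄(0, 3ρ)` and to the identity off `B(0, 3.4ρ)`, depending smoothly on
  `(L, y)`;
* `Literature.contractDiffeo ρ c` — a **compactly supported contraction**: a diffeomorphism equal to
  `c • id` (`0 < c ≤ 1`) on `B̄(0, 3.5ρ)` and to the identity off `B(0, 4ρ)` (a composition of
  near-identity contractions);
* `Literature.tubeFibreFun ε c L` — conjugating `contractDiffeo ∘ straightenDiffeo` (`ρ = 0.24 ε`) by
  Mathlib's diffeomorphism `univBall 0 ε : E ≅ B(0, ε)`: a bijective local diffeomorphism of `E`,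
  smooth in `(L, y)`, fixing `0`, equal to the identity off a fixed ball, and equal to
  `(univBall 0 ε)⁻¹ ∘ (c L) ∘ univBall 0 ε` on the closed unit ball — the fibre maps relating the
  tubes `(u, w) ↦ exp(γ(s) · univBall 0 ε w)` of two close framings `γ, γ'` with radii `ε`,
  `ε' = c ε` of the section circle of the Cappell–Shaneson mapping torus.

## References

* R. Gompf, A. Stipsicz, *4-Manifolds and Kirby Calculus*, GSM 20 (1999), §5.2. [GompfStipsiczGSM1999]
* M. W. Hirsch, *Differential Topology*, GTM 33 (1976), Ch. 8 §3, proof of Thm 3.1. [Hirsch1976]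
* J. M. Lee, *Introduction to Smooth Manifolds* (2013), Thm 4.5. [LeeSmoothManifolds2013]
-/

open scoped Manifold ContDiff Topology
open Set Function Metric

noncomputable section

namespace Literature.Topology.FourManifolds

/-! ### Fibrewise families of diffeomorphisms -/

section FibrewiseFun

variable {N E : Type*}

/-- The fibrewise map `(x, v) ↦ (x, F x v)` of a family `F : N → E → E`. [folklore] -/
def fibrewiseFun (F : N → E → E) (p : N × E) : N × E := (p.1, F p.1 p.2)

/-- The fibrewise map in coordinates (definitional). [folklore] -/
@[simp] theorem fibrewiseFun_apply (F : N → E → E) (x : N) (v : E) :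
    fibrewiseFun F (x, v) = (x, F x v) := rfl

/-- The fibrewise map of a family of bijections is bijective. [folklore] -/
theorem bijective_fibrewiseFun {F : N → E → E} (hbij : ∀ x, Bijective (F x)) :
    Bijective (fibrewiseFun F) := by
  refine ⟨fun p q h ↦ ?_, fun q ↦ ?_⟩
  · obtain ⟨x, v⟩ := p
    obtain ⟨x', v'⟩ := q
    simp only [fibrewiseFun_apply, Prod.mk.injEq] at h
    obtain ⟨rfl, h2⟩ := h
    exact Prod.ext rfl ((hbij x).1 h2)
  · obtain ⟨x, w⟩ := q
    obtain ⟨v, hv⟩ := (hbij x).2 w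
    exact ⟨(x, v), Prod.ext rfl hv⟩

end FibrewiseFun

section Fibrewise

variable {E : Type*} [NormedAddCommGroup E] [NormedSpace ℝ E]
  {EN : Type*} [NormedAddCommGroup EN] [NormedSpace ℝ EN]
  {HN : Type*} [TopologicalSpace HN] {J : ModelWithCorners ℝ EN HN}
  {N : Type*} [TopologicalSpace N] [ChartedSpace HN N]

/-- The fibrewise map of a jointly smooth family is smooth. [folklore] -/
theorem contMDiff_fibrewiseFun {F : N → E → E}
    (hF : ContMDiff (J.prod 𝓘(ℝ, E)) 𝓘(ℝ, E) ∞ (uncurry F)) :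
    ContMDiff (J.prod 𝓘(ℝ, E)) (J.prod 𝓘(ℝ, E)) ∞ (fibrewiseFun F) :=
  contMDiff_fst.prodMk hF

variable [CompleteSpace E] [CompleteSpace EN] [J.Boundaryless] [IsManifold J ∞ N]

/-- **A fibrewise family of local diffeomorphisms is a local diffeomorphism of the product.**
At `(x₀, v₀)`, read in the product chart, the differential of `(x, v) ↦ (x, F x v)` is the shear
`(ξ, w) ↦ (ξ, D (ξ, w))` with `w ↦ D (0, w)` the (invertible) differential of the stage `F x₀` at
`v₀`, i.e. Mathlib's `ContinuousLinearEquiv.skewProd`; conclude by the inverse function theorem on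
manifolds (`isLocalDiffeomorphAt_of_hasFDerivAt_writtenInExtChartAt`). Mirror image of
`AmbientIsotopy.isLocalDiffeomorph_trackFun` (parameter a manifold, fibre a vector space). [cite: LeeSmoothManifolds2013, Thm. 4.5] -/
theorem isLocalDiffeomorph_fibrewise {F : N → E → E}
    (hF : ContMDiff (J.prod 𝓘(ℝ, E)) 𝓘(ℝ, E) ∞ (uncurry F))
    (hloc : ∀ x, IsLocalDiffeomorph 𝓘(ℝ, E) 𝓘(ℝ, E) ∞ (F x)) :
    IsLocalDiffeomorph (J.prod 𝓘(ℝ, E)) (J.prod 𝓘(ℝ, E)) ∞ (fibrewiseFun F) := by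
  rintro ⟨x₀, v₀⟩
  set φ := extChartAt J x₀ with hφ
  -- the family read in the chart `φ` of the parameter
  set f₂ : EN × E → E := fun q => F (φ.symm q.1) q.2 with hf₂
  have hchart : extChartAt (J.prod 𝓘(ℝ, E)) ((x₀, v₀) : N × E) =
      φ.prod (PartialEquiv.refl E) := by
    rw [extChartAt_prod, extChartAt_model_space_eq_id]
  have hchart' : extChartAt (J.prod 𝓘(ℝ, E)) (fibrewiseFun F (x₀, v₀)) =
      φ.prod (PartialEquiv.refl E) := by
    rw [fibrewiseFun_apply, extChartAt_prod, extChartAt_model_space_eq_id]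
  have hpt : extChartAt (J.prod 𝓘(ℝ, E)) ((x₀, v₀) : N × E) (x₀, v₀) = (φ x₀, v₀) := by
    rw [hchart]
    rfl
  have hW : writtenInExtChartAt (J.prod 𝓘(ℝ, E)) (J.prod 𝓘(ℝ, E)) ((x₀, v₀) : N × E)
      (fibrewiseFun F) = fun q => (φ (φ.symm q.1), f₂ q) := by
    funext q
    rw [writtenInExtChartAt, hchart, hchart']
    rfl
  have hf₂W : writtenInExtChartAt (J.prod 𝓘(ℝ, E)) 𝓘(ℝ, E) ((x₀, v₀) : N × E) (uncurry F) =
      f₂ := by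
    funext q
    rw [writtenInExtChartAt, hchart]
    rfl
  -- `f₂` is differentiable at `(φ x₀, v₀)`
  have hFmd : MDifferentiableAt (J.prod 𝓘(ℝ, E)) 𝓘(ℝ, E) (uncurry F) (x₀, v₀) :=
    hF.contMDiffAt.mdifferentiableAt (by simp)
  have hf₂d : DifferentiableAt ℝ f₂ (φ x₀, v₀) := by
    have hd := hFmd.differentiableWithinAt_writtenInExtChartAt
    rw [ModelWithCorners.range_eq_univ, differentiableWithinAt_univ, hf₂W, hpt] at hd
    exact hd
  set D : EN × E →L[ℝ] E := fderiv ℝ f₂ (φ x₀, v₀) with hD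
  have hf₂' : HasFDerivAt f₂ D (φ x₀, v₀) := hf₂d.hasFDerivAt
  -- the differential of the stage `F x₀` at `v₀`, an equivalence `B` with `B w = D (0, w)`
  set B : E ≃L[ℝ] E := (hloc x₀ v₀).mfderivToContinuousLinearEquiv (by simp) with hBdef
  have hg₁ : writtenInExtChartAt 𝓘(ℝ, E) 𝓘(ℝ, E) v₀ (F x₀) = f₂ ∘ fun w => (φ x₀, w) := by
    funext w
    simp only [writtenInExtChartAt, extChartAt_model_space_eq_id, PartialEquiv.refl_coe,
      PartialEquiv.refl_symm, Function.comp_apply, hf₂, id_eq]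
    rw [extChartAt_to_inv]
  have hg₁' : HasFDerivAt (writtenInExtChartAt 𝓘(ℝ, E) 𝓘(ℝ, E) v₀ (F x₀))
      (D.comp (ContinuousLinearMap.inr ℝ EN E)) v₀ := by
    rw [hg₁]
    exact hf₂'.comp _ (hasFDerivAt_prodMk_right (φ x₀) v₀)
  have hB : ∀ w, B w = D (0, w) := by
    intro w
    have hmd : MDifferentiableAt 𝓘(ℝ, E) 𝓘(ℝ, E) (F x₀) v₀ :=
      (hloc x₀).contMDiff.contMDiffAt.mdifferentiableAt (by simp)
    have h1 : (B : E →L[ℝ] E) = mfderiv 𝓘(ℝ, E) 𝓘(ℝ, E) (F x₀) v₀ :=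
      (hloc x₀ v₀).mfderivToContinuousLinearEquiv_coe _
    have h2 : mfderiv 𝓘(ℝ, E) 𝓘(ℝ, E) (F x₀) v₀ = D.comp (ContinuousLinearMap.inr ℝ EN E) := by
      rw [hmd.mfderiv, ModelWithCorners.range_eq_univ, fderivWithin_univ,
        show (extChartAt 𝓘(ℝ, E) v₀) v₀ = v₀ by simp]
      exact hg₁'.fderiv
    change (B : E →L[ℝ] E) w = D (0, w)
    rw [h1, h2]
    rfl
  -- the differential read in charts is the shear `(ξ, w) ↦ (ξ, D (ξ, w))`
  set L : (EN × E) ≃L[ℝ] (EN × E) :=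
    (ContinuousLinearEquiv.refl ℝ EN).skewProd B (D.comp (ContinuousLinearMap.inl ℝ EN E)) with hL
  have hLD : (L : EN × E →L[ℝ] EN × E) = (ContinuousLinearMap.fst ℝ EN E).prod D := by
    refine ContinuousLinearMap.ext fun q => ?_
    obtain ⟨ξ, w⟩ := q
    have h : D (0, w) + D (ξ, 0) = D (ξ, w) := by
      rw [← map_add, Prod.mk_add_mk, zero_add, add_zero]
    rw [hL, ContinuousLinearEquiv.coe_coe, ContinuousLinearEquiv.skewProd_apply,
      ContinuousLinearMap.prod_apply]
    dsimp only
    rw [ContinuousLinearEquiv.refl_apply, ContinuousLinearMap.comp_apply,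
      ContinuousLinearMap.inl_apply, hB, h]
    rfl
  -- near `(φ x₀, v₀)` the first component `φ ∘ φ.symm` is the identity
  have hfst : HasFDerivAt (fun q : EN × E => φ (φ.symm q.1)) (ContinuousLinearMap.fst ℝ EN E)
      (φ x₀, v₀) := by
    have heq : (fun q : EN × E => φ (φ.symm q.1)) =ᶠ[𝓝 (φ x₀, v₀)] fun q => q.1 := by
      have ht : φ.target ∈ 𝓝 (φ x₀) := extChartAt_target_mem_nhds x₀
      filter_upwards [(continuous_fst.tendsto _).eventually ht] with q hq
      exact φ.right_inv hq
    exact hasFDerivAt_fst.congr_of_eventuallyEq heq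
  -- conclude by the inverse function theorem
  refine isLocalDiffeomorphAt_of_hasFDerivAt_writtenInExtChartAt isOpen_univ (mem_univ _)
    (contMDiff_fibrewiseFun hF).contMDiffOn (by exact_mod_cast le_top) L ?_
  rw [hW, hpt, hLD]
  exact hfst.prodMk hf₂'

/-- **A fibrewise family of bijective local diffeomorphisms, as a diffeomorphism of the
product.** [cite: LeeSmoothManifolds2013, Thm. 4.5] -/
def fibrewiseDiffeomorph {F : N → E → E}
    (hF : ContMDiff (J.prod 𝓘(ℝ, E)) 𝓘(ℝ, E) ∞ (uncurry F))
    (hloc : ∀ x, IsLocalDiffeomorph 𝓘(ℝ, E) 𝓘(ℝ, E) ∞ (F x)) (hbij : ∀ x, Bijective (F x)) :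
    (N × E) ≃ₘ⟮J.prod 𝓘(ℝ, E), J.prod 𝓘(ℝ, E)⟯ (N × E) :=
  (isLocalDiffeomorph_fibrewise hF hloc).diffeomorphOfBijective (bijective_fibrewiseFun hbij)

/-- The fibrewise diffeomorphism as a function (definitional). [folklore] -/
@[simp] theorem coe_fibrewiseDiffeomorph {F : N → E → E}
    (hF : ContMDiff (J.prod 𝓘(ℝ, E)) 𝓘(ℝ, E) ∞ (uncurry F))
    (hloc : ∀ x, IsLocalDiffeomorph 𝓘(ℝ, E) 𝓘(ℝ, E) ∞ (F x)) (hbij : ∀ x, Bijective (F x)) :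
    ⇑(fibrewiseDiffeomorph hF hloc hbij) = fibrewiseFun F := rfl

end Fibrewise

/-! ### Cut-offs at scale `ρ` and the near-identity straightening -/

section Straighten

variable {E : Type*} [NormedAddCommGroup E] [NormedSpace ℝ E] [FiniteDimensional ℝ E]

/-- A bound for the derivative of a bump function (which has compact support), chosen
nonnegative. [folklore] -/
def bumpBound (χ : ContDiffBump (0 : E)) : ℝ :=
  max (Classical.choose ((χ.hasCompactSupport.fderiv ℝ).exists_bound_of_continuous
    (χ.contDiff.continuous_fderiv (by simp : ((⊤ : ℕ∞) : WithTop ℕ∞) ≠ 0)))) 0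

/-- `bumpBound χ ≥ 0`. [folklore] -/
theorem bumpBound_nonneg (χ : ContDiffBump (0 : E)) : 0 ≤ bumpBound χ :=
  le_max_right _ _

/-- `‖Dχ‖ ≤ bumpBound χ` everywhere. [folklore] -/
theorem norm_fderiv_le_bumpBound (χ : ContDiffBump (0 : E)) (z : E) :
    ‖fderiv ℝ χ z‖ ≤ bumpBound χ :=
  (Classical.choose_spec ((χ.hasCompactSupport.fderiv ℝ).exists_bound_of_continuous
    (χ.contDiff.continuous_fderiv (by simp : ((⊤ : ℕ∞) : WithTop ℕ∞) ≠ 0))) z).trans (le_max_left _ _)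

/-- **The cut-off at scale `ρ`**: `y ↦ χ (y / ρ)`, equal to `1` on `B̄(0, ρ rIn)` and to `0` off
`B(0, ρ rOut)`. [cite: Hirsch1976, Ch. 8 §3, proof of Thm 3.1 (inserting a bump function)] -/
def cutAt (χ : ContDiffBump (0 : E)) (ρ : ℝ) (y : E) : ℝ := χ (ρ⁻¹ • y)

variable (χ : ContDiffBump (0 : E)) {ρ : ℝ}

/-- The cut-off is `1` on the inner ball. [folklore] -/
theorem cutAt_eq_one (hρ : 0 < ρ) {y : E} (hy : ‖y‖ ≤ ρ * χ.rIn) : cutAt χ ρ y = 1 := by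
  apply χ.one_of_mem_closedBall
  rw [mem_closedBall, dist_zero_right, norm_smul, norm_inv, Real.norm_of_nonneg hρ.le,
    inv_mul_le_iff₀ hρ]
  exact hy

/-- The cut-off is `0` off the outer ball. [folklore] -/
theorem cutAt_eq_zero (hρ : 0 < ρ) {y : E} (hy : ρ * χ.rOut ≤ ‖y‖) : cutAt χ ρ y = 0 := by
  apply χ.zero_of_le_dist
  rw [dist_zero_right, norm_smul, norm_inv, Real.norm_of_nonneg hρ.le, le_inv_mul_iff₀ hρ]
  exact hy

/-- `0 ≤ cutAt ≤ 1`. [folklore] -/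
theorem abs_cutAt_le (y : E) : |cutAt χ ρ y| ≤ 1 := by
  unfold cutAt
  rw [abs_of_nonneg (χ.nonneg' _)]
  exact χ.le_one

/-- The cut-off is smooth. [folklore] -/
theorem contDiff_cutAt : ContDiff ℝ ∞ (cutAt χ ρ) :=
  χ.contDiff.comp (contDiff_const_smul ρ⁻¹)

/-- The derivative of the cut-off is bounded by `bumpBound χ / ρ`. [folklore] -/
theorem norm_fderiv_cutAt_le (hρ : 0 < ρ) (y : E) :
    ‖fderiv ℝ (cutAt χ ρ) y‖ ≤ bumpBound χ / ρ := by
  have h1 : HasFDerivAt (cutAt χ ρ) ((fderiv ℝ χ (ρ⁻¹ • y)).comp (ρ⁻¹ • ContinuousLinearMap.id ℝ E)) y := by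
    have hd : HasFDerivAt (χ : E → ℝ) (fderiv ℝ χ (ρ⁻¹ • y)) (ρ⁻¹ • y) :=
      (χ.contDiff.differentiable (n := ((⊤ : ℕ∞) : WithTop ℕ∞)) (by simp)).differentiableAt.hasFDerivAt
    exact hd.comp y ((hasFDerivAt_id y).const_smul ρ⁻¹)
  rw [h1.fderiv]
  refine (ContinuousLinearMap.opNorm_comp_le _ _).trans ?_
  have h2 : ‖ρ⁻¹ • ContinuousLinearMap.id ℝ E‖ ≤ ρ⁻¹ := by
    rw [norm_smul, norm_inv, Real.norm_of_nonneg hρ.le]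
    exact mul_le_of_le_one_right (inv_nonneg.2 hρ.le) ContinuousLinearMap.norm_id_le
  calc ‖fderiv ℝ (⇑χ) (ρ⁻¹ • y)‖ * ‖ρ⁻¹ • ContinuousLinearMap.id ℝ E‖
      ≤ bumpBound χ * ρ⁻¹ := mul_le_mul (norm_fderiv_le_bumpBound χ _) h2 (norm_nonneg _)
        (bumpBound_nonneg χ)
    _ = bumpBound χ / ρ := by rw [div_eq_mul_inv]

/-- Off the outer ball the derivative of the cut-off vanishes (the cut-off is locally zero). [folklore] -/
theorem fderiv_cutAt_eq_zero (hρ : 0 < ρ) {y : E} (hy : ρ * χ.rOut < ‖y‖) :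
    fderiv ℝ (cutAt χ ρ) y = 0 := by
  have h : cutAt χ ρ =ᶠ[𝓝 y] fun _ ↦ (0 : ℝ) := by
    have ho : IsOpen {z : E | ρ * χ.rOut < ‖z‖} := isOpen_lt continuous_const continuous_norm
    filter_upwards [ho.mem_nhds hy] with z hz
    exact cutAt_eq_zero χ hρ hz.le
  rw [h.fderiv_eq]
  exact fderiv_const_apply 0

/-- **The straightening `y ↦ y + χ(y/ρ) (L y - y)`** of a continuous linear map `L`: equal to
`L` on `B̄(0, ρ rIn)`, to the identity off `B(0, ρ rOut)` ("inserting a bump function",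
Hirsch, Ch. 8 §3). [cite: Hirsch1976, Ch. 8 §3, proof of Thm 3.1 (inserting a bump function)] -/
def straightenFun (ρ : ℝ) (L : E →L[ℝ] E) (y : E) : E := y + cutAt χ ρ y • (L y - y)

/-- On the inner ball the straightening is `L`. [folklore] -/
theorem straightenFun_of_norm_le (hρ : 0 < ρ) (L : E →L[ℝ] E) {y : E} (hy : ‖y‖ ≤ ρ * χ.rIn) :
    straightenFun χ ρ L y = L y := by
  rw [straightenFun, cutAt_eq_one χ hρ hy, one_smul, add_sub_cancel]

/-- Off the outer ball the straightening is the identity. [folklore] -/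
theorem straightenFun_of_le_norm (hρ : 0 < ρ) (L : E →L[ℝ] E) {y : E} (hy : ρ * χ.rOut ≤ ‖y‖) :
    straightenFun χ ρ L y = y := by
  rw [straightenFun, cutAt_eq_zero χ hρ hy, zero_smul, add_zero]

/-- The straightening of the identity is the identity. [folklore] -/
@[simp] theorem straightenFun_one (ρ : ℝ) : straightenFun χ ρ (1 : E →L[ℝ] E) = id := by
  funext y
  simp [straightenFun]

/-- The straightening fixes `0`. [folklore] -/
@[simp] theorem straightenFun_apply_zero (ρ : ℝ) (L : E →L[ℝ] E) : straightenFun χ ρ L 0 = 0 := by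
  simp [straightenFun]

/-- **The straightening is jointly smooth in `(L, y)`.** [folklore] -/
theorem contDiff_straightenFun_uncurry (ρ : ℝ) :
    ContDiff ℝ ∞ fun p : (E →L[ℝ] E) × E ↦ straightenFun χ ρ p.1 p.2 := by
  unfold straightenFun
  have h1 : ContDiff ℝ ∞ fun p : (E →L[ℝ] E) × E ↦ cutAt χ ρ p.2 := (contDiff_cutAt χ).comp contDiff_snd
  have h2 : ContDiff ℝ ∞ fun p : (E →L[ℝ] E) × E ↦ p.1 p.2 := isBoundedBilinearMap_apply.contDiff
  exact contDiff_snd.add (h1.smul (h2.sub contDiff_snd))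

/-- The straightening is smooth. [folklore] -/
theorem contDiff_straightenFun (ρ : ℝ) (L : E →L[ℝ] E) : ContDiff ℝ ∞ (straightenFun χ ρ L) :=
  (contDiff_straightenFun_uncurry χ ρ).comp (contDiff_const.prodMk contDiff_id)

/-- The derivative of the straightening. [folklore] -/
theorem hasFDerivAt_straightenFun (ρ : ℝ) (L : E →L[ℝ] E) (y : E) :
    HasFDerivAt (straightenFun χ ρ L)
      (ContinuousLinearMap.id ℝ E + (cutAt χ ρ y • (L - ContinuousLinearMap.id ℝ E) +
        (fderiv ℝ (cutAt χ ρ) y).smulRight (L y - y))) y := by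
  have hc : HasFDerivAt (cutAt χ ρ) (fderiv ℝ (cutAt χ ρ) y) y :=
    ((contDiff_cutAt χ).differentiable (by simp) y).hasFDerivAt
  have hL : HasFDerivAt (fun y ↦ L y - y) (L - ContinuousLinearMap.id ℝ E) y :=
    L.hasFDerivAt.sub (hasFDerivAt_id y)
  have := (hasFDerivAt_id y).add (hc.smul hL)
  convert this using 1
  funext z
  simp [straightenFun]

/-- **The straightening is `C¹`-close to the identity**: `‖D(straighten) - id‖ ≤ (1 + C rOut) ‖L - 1‖`
with `C = bumpBound χ`. [cite: Hirsch1976, Ch. 8 §3, proof of Thm 3.1 (inserting a bump function)] -/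
theorem norm_fderiv_straightenFun_sub_id_le (hρ : 0 < ρ) (L : E →L[ℝ] E)
    (y : E) : ‖fderiv ℝ (straightenFun χ ρ L) y - ContinuousLinearMap.id ℝ E‖ ≤
      (1 + bumpBound χ * χ.rOut) * ‖L - 1‖ := by
  rw [(hasFDerivAt_straightenFun χ ρ L y).fderiv, add_sub_cancel_left]
  have hC := bumpBound_nonneg χ
  have hOut := χ.rOut_pos
  have hL1 : ‖L - 1‖ = ‖L - ContinuousLinearMap.id ℝ E‖ := rfl
  by_cases hy : ‖y‖ ≤ ρ * χ.rOut
  · refine (norm_add_le _ _).trans ?_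
    have h1 : ‖cutAt χ ρ y • (L - ContinuousLinearMap.id ℝ E)‖ ≤ ‖L - 1‖ := by
      rw [norm_smul, hL1]
      exact mul_le_of_le_one_left (norm_nonneg _) (abs_cutAt_le χ y)
    have h2 : ‖(fderiv ℝ (cutAt χ ρ) y).smulRight (L y - y)‖ ≤ bumpBound χ * χ.rOut * ‖L - 1‖ := by
      rw [ContinuousLinearMap.norm_smulRight_apply]
      have h3 : ‖L y - y‖ ≤ ‖L - 1‖ * ‖y‖ := by
        have : L y - y = (L - 1) y := by simp
        rw [this]
        exact (L - 1).le_opNorm y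
      calc ‖fderiv ℝ (cutAt χ ρ) y‖ * ‖L y - y‖
          ≤ (bumpBound χ / ρ) * (‖L - 1‖ * (ρ * χ.rOut)) := by
            refine mul_le_mul (norm_fderiv_cutAt_le χ hρ y) (h3.trans ?_) (norm_nonneg _)
              (div_nonneg hC hρ.le)
            exact mul_le_mul_of_nonneg_left hy (norm_nonneg _)
        _ = bumpBound χ * χ.rOut * ‖L - 1‖ := by
            field_simp
    calc ‖cutAt χ ρ y • (L - ContinuousLinearMap.id ℝ E)‖ + ‖(fderiv ℝ (cutAt χ ρ) y).smulRight (L y - y)‖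
        ≤ ‖L - 1‖ + bumpBound χ * χ.rOut * ‖L - 1‖ := add_le_add h1 h2
      _ = (1 + bumpBound χ * χ.rOut) * ‖L - 1‖ := by ring
  · have hy' : ρ * χ.rOut < ‖y‖ := not_le.1 hy
    rw [cutAt_eq_zero χ hρ hy'.le, fderiv_cutAt_eq_zero χ hρ hy', zero_smul, zero_add,
      ContinuousLinearMap.zero_smulRight, norm_zero]
    positivity

/-- The smallness threshold for `‖L - 1‖` under which the straightening is a diffeomorphism. [folklore] -/
def straightenThreshold (χ : ContDiffBump (0 : E)) : ℝ :=
  1 / (2 * (1 + bumpBound χ * χ.rOut))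

/-- The threshold is positive. [folklore] -/
theorem straightenThreshold_pos : 0 < straightenThreshold χ := by
  have := bumpBound_nonneg χ
  have := χ.rOut_pos
  unfold straightenThreshold
  positivity

variable [CompleteSpace E]

/-- **The straightening as a diffeomorphism of `E`** for `‖L - 1‖` below the threshold (a
`C¹`-small perturbation of the identity, `Diffeomorph.ofNormFDerivSubIdLe`). [cite: Hirsch1976, Ch. 8 §3, proof of Thm 3.1 (inserting a bump function)] -/
def straightenDiffeo (hρ : 0 < ρ) (L : E →L[ℝ] E) (hL : ‖L - 1‖ ≤ straightenThreshold χ) :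
    E ≃ₘ⟮𝓘(ℝ, E), 𝓘(ℝ, E)⟯ E :=
  Diffeomorph.ofNormFDerivSubIdLe (straightenFun χ ρ L) (contDiff_straightenFun χ ρ L) (by simp)
    fun y ↦ (norm_fderiv_straightenFun_sub_id_le χ hρ L y).trans (by
      have h0 : 0 < 1 + bumpBound χ * χ.rOut := by
        have := bumpBound_nonneg χ; have := χ.rOut_pos; positivity
      calc (1 + bumpBound χ * χ.rOut) * ‖L - 1‖
          ≤ (1 + bumpBound χ * χ.rOut) * straightenThreshold χ :=
            mul_le_mul_of_nonneg_left hL h0.le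
        _ = 1 / 2 := by unfold straightenThreshold; field_simp)

/-- The straightening diffeomorphism as a function (definitional). [folklore] -/
@[simp] theorem coe_straightenDiffeo (hρ : 0 < ρ) (L : E →L[ℝ] E)
    (hL : ‖L - 1‖ ≤ straightenThreshold χ) : ⇑(straightenDiffeo χ hρ L hL) = straightenFun χ ρ L :=
  rfl

end Straighten

/-! ### Compactly supported contractions -/

section Contract

variable {E : Type*} [NormedAddCommGroup E] [NormedSpace ℝ E]

/-- Iterated composition of a self-diffeomorphism. [folklore] -/
def iterTrans (D : E ≃ₘ⟮𝓘(ℝ, E), 𝓘(ℝ, E)⟯ E) : ℕ → (E ≃ₘ⟮𝓘(ℝ, E), 𝓘(ℝ, E)⟯ E)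
  | 0 => Diffeomorph.refl _ _ _
  | n + 1 => (iterTrans D n).trans D

/-- The iterated composition is the iterate. [folklore] -/
@[simp] theorem coe_iterTrans (D : E ≃ₘ⟮𝓘(ℝ, E), 𝓘(ℝ, E)⟯ E) (n : ℕ) : ⇑(iterTrans D n) = D^[n] := by
  induction n with
  | zero => rfl
  | succ n ih =>
    rw [iterTrans, Diffeomorph.coe_trans, ih, Function.iterate_succ']

/-- The `(m+1)`-st root `c^{1/(m+1)} = exp (log c / (m + 1))` of `c > 0`. [folklore] -/
def nthRootOf (c : ℝ) (m : ℕ) : ℝ := Real.exp (Real.log c / ((m : ℝ) + 1))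

/-- The root is positive. [folklore] -/
theorem nthRootOf_pos (c : ℝ) (m : ℕ) : 0 < nthRootOf c m := Real.exp_pos _

/-- The root of `c ≤ 1` is at most `1`. [folklore] -/
theorem nthRootOf_le_one {c : ℝ} (hc : 0 < c) (hc1 : c ≤ 1) (m : ℕ) : nthRootOf c m ≤ 1 := by
  rw [nthRootOf, Real.exp_le_one_iff]
  exact div_nonpos_of_nonpos_of_nonneg (Real.log_nonpos hc.le hc1) (by positivity)

/-- `(c^{1/(m+1)})^{m+1} = c`. [folklore] -/
theorem nthRootOf_pow {c : ℝ} (hc : 0 < c) (m : ℕ) : nthRootOf c m ^ (m + 1) = c := by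
  rw [nthRootOf, ← Real.exp_nat_mul, Nat.cast_add_one, mul_div_cancel₀ _ (by positivity),
    Real.exp_log hc]

/-- The roots tend to `1`. [folklore] -/
theorem tendsto_nthRootOf (c : ℝ) : Filter.Tendsto (nthRootOf c) Filter.atTop (𝓝 1) := by
  have h1 : Filter.Tendsto (fun m : ℕ ↦ Real.log c / ((m : ℝ) + 1)) Filter.atTop (𝓝 0) :=
    tendsto_const_nhds.div_atTop
      (Filter.tendsto_atTop_add_const_right _ 1 tendsto_natCast_atTop_atTop)
  show Filter.Tendsto (fun m : ℕ ↦ Real.exp (Real.log c / ((m : ℝ) + 1))) Filter.atTop (𝓝 1)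
  simpa [Function.comp_def] using (Real.continuous_exp.tendsto 0).comp h1

/-- For some `m`, the root is within `η` of `1`. [folklore] -/
theorem exists_abs_nthRootOf_sub_one_le (c : ℝ) {η : ℝ} (hη : 0 < η) :
    ∃ m : ℕ, |nthRootOf c m - 1| ≤ η := by
  have := (Metric.tendsto_nhds.mp (tendsto_nthRootOf c)) η hη
  obtain ⟨m, hm⟩ := this.exists
  exact ⟨m, by rw [Real.dist_eq] at hm; exact hm.le⟩

/-- `‖a • 1 - 1‖ ≤ |a - 1|` for the identity of `E`. [folklore] -/
theorem norm_smul_one_sub_one_le (a : ℝ) : ‖a • (1 : E →L[ℝ] E) - 1‖ ≤ |a - 1| := by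
  rw [show a • (1 : E →L[ℝ] E) - 1 = (a - 1) • 1 by rw [sub_smul, one_smul], norm_smul,
    Real.norm_eq_abs]
  exact mul_le_of_le_one_right (abs_nonneg _) ContinuousLinearMap.norm_id_le

/-- A bump with `rIn = 7/2`, `rOut = 4` for the contraction. [folklore] -/
def contractBump : ContDiffBump (0 : E) := ⟨7 / 2, 4, by norm_num, by norm_num⟩

variable [FiniteDimensional ℝ E]

open scoped Classical in
/-- The number of near-identity steps used to contract by the factor `c`. [folklore] -/
def contractSteps (c : ℝ) : ℕ :=
  Nat.find (exists_abs_nthRootOf_sub_one_le c (straightenThreshold_pos (contractBump (E := E))))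

open scoped Classical in
/-- The contraction factor of one step is within the straightening threshold of `1`. [folklore] -/
theorem abs_contractRoot_sub_one_le (c : ℝ) :
    |nthRootOf c (contractSteps (E := E) c) - 1| ≤ straightenThreshold (contractBump (E := E)) :=
  Nat.find_spec (exists_abs_nthRootOf_sub_one_le c (straightenThreshold_pos (contractBump (E := E))))

variable [CompleteSpace E]

/-- **One contraction step** `y ↦ y + χ(y/ρ) (a - 1) y`, a diffeomorphism equal to `a • id` on
`B̄(0, 7ρ/2)` and to the identity off `B(0, 4ρ)`, `a = c^{1/(m+1)}`. [cite: Hirsch1976, Ch. 8 §3, proof of Thm 3.1 (inserting a bump function)] -/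
def contractStep {ρ : ℝ} (hρ : 0 < ρ) (c : ℝ) : E ≃ₘ⟮𝓘(ℝ, E), 𝓘(ℝ, E)⟯ E :=
  straightenDiffeo contractBump hρ (nthRootOf c (contractSteps (E := E) c) • 1)
    ((norm_smul_one_sub_one_le _).trans (abs_contractRoot_sub_one_le c))

/-- **The compactly supported contraction by the factor `c ∈ (0, 1]`**: `m + 1` contraction
steps, equal to `c • id` on `B̄(0, 7ρ/2)` and to the identity off `B(0, 4ρ)`. [cite: Hirsch1976, Ch. 8 §3, proof of Thm 3.1 (inserting a bump function)] -/
def contractDiffeo {ρ : ℝ} (hρ : 0 < ρ) (c : ℝ) : E ≃ₘ⟮𝓘(ℝ, E), 𝓘(ℝ, E)⟯ E :=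
  iterTrans (contractStep hρ c) (contractSteps (E := E) c + 1)

/-- One step is multiplication by the root on the inner ball. [folklore] -/
theorem contractStep_of_norm_le {ρ : ℝ} (hρ : 0 < ρ) (c : ℝ) {y : E} (hy : ‖y‖ ≤ ρ * (7 / 2)) :
    contractStep hρ c y = nthRootOf c (contractSteps (E := E) c) • y := by
  rw [contractStep, coe_straightenDiffeo, straightenFun_of_norm_le _ hρ _ hy]
  simp

/-- One step is the identity off the outer ball. [folklore] -/
theorem contractStep_of_le_norm {ρ : ℝ} (hρ : 0 < ρ) (c : ℝ) {y : E} (hy : ρ * 4 ≤ ‖y‖) :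
    contractStep hρ c y = y := by
  rw [contractStep, coe_straightenDiffeo, straightenFun_of_le_norm _ hρ _ hy]

/-- **On `B̄(0, 7ρ/2)` the contraction is `c • id`** (for `0 < c ≤ 1` every step keeps the inner
ball). [cite: Hirsch1976, Ch. 8 §3, proof of Thm 3.1 (inserting a bump function)] -/
theorem contractDiffeo_of_norm_le {ρ : ℝ} (hρ : 0 < ρ) {c : ℝ} (hc : 0 < c) (hc1 : c ≤ 1) {y : E}
    (hy : ‖y‖ ≤ ρ * (7 / 2)) : contractDiffeo hρ c y = c • y := by
  set a := nthRootOf c (contractSteps (E := E) c) with ha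
  have ha0 : 0 < a := nthRootOf_pos _ _
  have ha1 : a ≤ 1 := nthRootOf_le_one hc hc1 _
  have key : ∀ n : ℕ, (contractStep hρ c)^[n] y = a ^ n • y := by
    intro n
    induction n with
    | zero => simp
    | succ n ih =>
      rw [Function.iterate_succ', Function.comp_apply, ih, contractStep_of_norm_le hρ c, ← ha,
        smul_smul, ← pow_succ']
      rw [norm_smul, Real.norm_of_nonneg (pow_nonneg ha0.le n)]
      exact (mul_le_of_le_one_left (norm_nonneg _) (pow_le_one₀ ha0.le ha1)).trans hy
  rw [contractDiffeo, coe_iterTrans, key, ha, nthRootOf_pow hc]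

/-- **Off `B(0, 4ρ)` the contraction is the identity.** [cite: Hirsch1976, Ch. 8 §3, proof of Thm 3.1 (inserting a bump function)] -/
theorem contractDiffeo_of_le_norm {ρ : ℝ} (hρ : 0 < ρ) (c : ℝ) {y : E} (hy : ρ * 4 ≤ ‖y‖) :
    contractDiffeo hρ c y = y := by
  have key : ∀ n : ℕ, (contractStep hρ c)^[n] y = y := by
    intro n
    induction n with
    | zero => rfl
    | succ n ih => rw [Function.iterate_succ', Function.comp_apply, ih, contractStep_of_le_norm hρ c hy]
  rw [contractDiffeo, coe_iterTrans, key]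

/-- The contraction fixes `0`. [folklore] -/
@[simp] theorem contractDiffeo_apply_zero {ρ : ℝ} (hρ : 0 < ρ) (c : ℝ) : contractDiffeo hρ c (0 : E) = 0 := by
  have key : ∀ n : ℕ, (contractStep hρ c)^[n] (0 : E) = 0 := by
    intro n
    induction n with
    | zero => rfl
    | succ n ih =>
      rw [Function.iterate_succ', Function.comp_apply, ih, contractStep, coe_straightenDiffeo,
        straightenFun_apply_zero]
  rw [contractDiffeo, coe_iterTrans, key]

end Contract

/-! ### Conjugating by `univBall`: the fibre maps relating two close framings -/

section TubeFibre

variable {E : Type*} [NormedAddCommGroup E] [InnerProductSpace ℝ E] [FiniteDimensional ℝ E]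
  [CompleteSpace E]

open OpenPartialHomeomorph

omit [FiniteDimensional ℝ E] [CompleteSpace E] in
/-- Mathlib's diffeomorphism `univBall 0 ε : E ≅ B(0, ε)` in closed form:
`y ↦ ε (1 + ‖y‖²)^{-1/2} y`. [folklore] -/
theorem univBall_zero_eq_smul {ε : ℝ} (hε : 0 < ε) (y : E) :
    univBall (0 : E) ε y = ε • ((Real.sqrt (1 + ‖y‖ ^ 2))⁻¹ • y) := by
  rw [univBall, dif_pos hε]
  simp [univUnitBall_apply]

omit [FiniteDimensional ℝ E] [CompleteSpace E] in
/-- The norm of `univBall 0 ε y` is `ε ‖y‖ / √(1 + ‖y‖²)`. [folklore] -/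
theorem norm_univBall_zero {ε : ℝ} (hε : 0 < ε) (y : E) :
    ‖univBall (0 : E) ε y‖ = ε * ‖y‖ / Real.sqrt (1 + ‖y‖ ^ 2) := by
  have h : 0 < Real.sqrt (1 + ‖y‖ ^ 2) := Real.sqrt_pos.2 (by positivity)
  rw [univBall_zero_eq_smul hε, norm_smul, norm_smul, norm_inv, Real.norm_of_nonneg hε.le,
    Real.norm_of_nonneg h.le]
  field_simp

omit [FiniteDimensional ℝ E] [CompleteSpace E] in
/-- `‖univBall 0 ε y‖ < ε`. [folklore] -/
theorem norm_univBall_zero_lt {ε : ℝ} (hε : 0 < ε) (y : E) : ‖univBall (0 : E) ε y‖ < ε := by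
  have := (univBall (0 : E) ε).map_source (x := y) (by rw [univBall_source]; exact mem_univ _)
  rw [univBall_target _ hε, mem_ball_zero_iff] at this
  exact this

omit [FiniteDimensional ℝ E] [CompleteSpace E] in
/-- On the closed unit ball, `‖univBall 0 ε y‖ ≤ ε/√2 ≤ (18/25) ε`. [folklore] -/
theorem norm_univBall_zero_le {ε : ℝ} (hε : 0 < ε) {y : E} (hy : ‖y‖ ≤ 1) :
    ‖univBall (0 : E) ε y‖ ≤ ε * (18 / 25) := by
  rw [norm_univBall_zero hε]
  have h1 : 0 < Real.sqrt (1 + ‖y‖ ^ 2) := Real.sqrt_pos.2 (by positivity)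
  have h2 : Real.sqrt (1 + ‖y‖ ^ 2) ^ 2 = 1 + ‖y‖ ^ 2 := Real.sq_sqrt (by positivity)
  rw [div_le_iff₀ h1]
  have hn := norm_nonneg y
  -- `‖y‖ ≤ (18/25) √(1 + ‖y‖²)` as `‖y‖² ≤ (18/25)² (1 + ‖y‖²)`
  nlinarith [sq_nonneg (Real.sqrt (1 + ‖y‖ ^ 2) - 1), mul_nonneg hε.le hn]

omit [FiniteDimensional ℝ E] [CompleteSpace E] in
/-- Off the ball of radius `7/2`, `‖univBall 0 ε y‖ ≥ (24/25) ε`. [folklore] -/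
theorem le_norm_univBall_zero {ε : ℝ} (hε : 0 < ε) {y : E} (hy : 7 / 2 ≤ ‖y‖) :
    ε * (24 / 25) ≤ ‖univBall (0 : E) ε y‖ := by
  rw [norm_univBall_zero hε]
  have h1 : 0 < Real.sqrt (1 + ‖y‖ ^ 2) := Real.sqrt_pos.2 (by positivity)
  have h2 : Real.sqrt (1 + ‖y‖ ^ 2) ^ 2 = 1 + ‖y‖ ^ 2 := Real.sq_sqrt (by positivity)
  rw [le_div_iff₀ h1]
  -- `(24/25) √(1 + ‖y‖²) ≤ ‖y‖` as `(24/25)² (1 + ‖y‖²) ≤ ‖y‖²`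
  nlinarith [mul_pos hε h1]

/-- The radius `ρ = (6/25) ε` of the straightenings inside `B(0, ε)`. [folklore] -/
def coreRadius (ε : ℝ) : ℝ := 6 / 25 * ε

/-- `ρ > 0`. [folklore] -/
theorem coreRadius_pos {ε : ℝ} (hε : 0 < ε) : 0 < coreRadius ε := by unfold coreRadius; positivity

/-- A bump with `rIn = 3`, `rOut = 17/5` for the straightening. [folklore] -/
def coreBump : ContDiffBump (0 : E) := ⟨3, 17 / 5, by norm_num, by norm_num⟩

/-- **The core map `T = (contraction by c) ∘ (straightening of L)`** on `E`, supported in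
`B(0, 4ρ) ⊆ B(0, ε)`. [cite: Hirsch1976, Ch. 8 §3, proof of Thm 3.1 (inserting a bump function)] -/
def tubeCoreFun {ε : ℝ} (hε : 0 < ε) (c : ℝ) (L : E →L[ℝ] E) : E → E :=
  contractDiffeo (coreRadius_pos hε) c ∘ straightenFun coreBump (coreRadius ε) L

variable {ε : ℝ} (hε : 0 < ε)

/-- Off `B(0, (24/25) ε)` the core map is the identity. [folklore] -/
theorem tubeCoreFun_of_le_norm (c : ℝ) (L : E →L[ℝ] E) {y : E} (hy : ε * (24 / 25) ≤ ‖y‖) :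
    tubeCoreFun hε c L y = y := by
  have hρ := coreRadius_pos hε
  have h1 : coreRadius ε * (coreBump (E := E)).rOut ≤ ‖y‖ := by
    show 6 / 25 * ε * (17 / 5) ≤ ‖y‖; linarith
  rw [tubeCoreFun, Function.comp_apply, straightenFun_of_le_norm _ hρ _ h1,
    contractDiffeo_of_le_norm hρ c (by show 6 / 25 * ε * 4 ≤ ‖y‖; linarith)]

/-- **On `B̄(0, (18/25) ε)` the core map is `c • L`** (for `‖L‖ ≤ 7/6`, `0 < c ≤ 1`). [folklore] -/
theorem tubeCoreFun_of_norm_le {c : ℝ} (hc : 0 < c) (hc1 : c ≤ 1) {L : E →L[ℝ] E}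
    (hL : ‖L‖ ≤ 7 / 6) {y : E} (hy : ‖y‖ ≤ ε * (18 / 25)) : tubeCoreFun hε c L y = c • L y := by
  have hρ := coreRadius_pos hε
  have h1 : ‖y‖ ≤ coreRadius ε * (coreBump (E := E)).rIn := by
    show ‖y‖ ≤ 6 / 25 * ε * 3; linarith
  rw [tubeCoreFun, Function.comp_apply, straightenFun_of_norm_le _ hρ _ h1,
    contractDiffeo_of_norm_le hρ hc hc1]
  calc ‖L y‖ ≤ ‖L‖ * ‖y‖ := L.le_opNorm y
    _ ≤ 7 / 6 * (ε * (18 / 25)) := mul_le_mul hL hy (norm_nonneg _) (by norm_num)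
    _ = coreRadius ε * (7 / 2) := by unfold coreRadius; ring

/-- The core map fixes `0`. [folklore] -/
@[simp] theorem tubeCoreFun_apply_zero (c : ℝ) (L : E →L[ℝ] E) : tubeCoreFun hε c L 0 = 0 := by
  rw [tubeCoreFun, Function.comp_apply, straightenFun_apply_zero, contractDiffeo_apply_zero]

/-- The core map is jointly smooth in `(L, y)`. [folklore] -/
theorem contDiff_tubeCoreFun_uncurry (c : ℝ) :
    ContDiff ℝ ∞ fun p : (E →L[ℝ] E) × E ↦ tubeCoreFun hε c p.1 p.2 := by
  have h1 : ContDiff ℝ ∞ (contractDiffeo (E := E) (coreRadius_pos hε) c) :=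
    contMDiff_iff_contDiff.1 (contractDiffeo (coreRadius_pos hε) c).contMDiff
  exact h1.comp (contDiff_straightenFun_uncurry coreBump _)

/-- The core map is smooth. [folklore] -/
theorem contDiff_tubeCoreFun (c : ℝ) (L : E →L[ℝ] E) : ContDiff ℝ ∞ (tubeCoreFun hε c L) :=
  (contDiff_tubeCoreFun_uncurry hε c).comp (contDiff_const.prodMk contDiff_id)

/-- **For `‖L - 1‖` below the threshold the core map is a composition of two diffeomorphisms**,
in particular bijective. [folklore] -/
theorem tubeCoreFun_eq_comp (c : ℝ) {L : E →L[ℝ] E} (hL : ‖L - 1‖ ≤ straightenThreshold (coreBump (E := E))) :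
    tubeCoreFun hε c L = contractDiffeo (coreRadius_pos hε) c ∘ straightenDiffeo coreBump (coreRadius_pos hε) L hL :=
  rfl

omit [InnerProductSpace ℝ E] [FiniteDimensional ℝ E] [CompleteSpace E] in
/-- A bijection of `E` that is the identity off `B(0, r)` maps `B(0, r)` onto itself. [folklore] -/
theorem norm_lt_of_bijective_of_eq_self {T : E → E} (hT : Bijective T) {r : ℝ}
    (h : ∀ y, r ≤ ‖y‖ → T y = y) {y : E} (hy : ‖y‖ < r) : ‖T y‖ < r := by
  by_contra h'
  have h1 : T (T y) = T y := h _ (not_lt.1 h')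
  have h2 : T y = y := hT.1 h1
  rw [h2] at h'
  exact h' hy

/-- The core map preserves `B(0, ε)` (it is the identity near and beyond the sphere
`‖y‖ = (24/25) ε`). [folklore] -/
theorem norm_tubeCoreFun_lt (c : ℝ) {L : E →L[ℝ] E} (hL : ‖L - 1‖ ≤ straightenThreshold (coreBump (E := E)))
    {y : E} (hy : ‖y‖ < ε) : ‖tubeCoreFun hε c L y‖ < ε := by
  refine norm_lt_of_bijective_of_eq_self ?_ (fun z hz ↦ tubeCoreFun_of_le_norm hε c L ?_) hy
  · rw [tubeCoreFun_eq_comp hε c hL]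
    exact (contractDiffeo (coreRadius_pos hε) c).bijective.comp
      (straightenDiffeo coreBump (coreRadius_pos hε) L hL).bijective
  · linarith

/-- **The fibre map `(univBall 0 ε)⁻¹ ∘ T ∘ univBall 0 ε`** on `E`. [cite: GompfStipsiczGSM1999, §5.2] -/
def tubeFibreFun (c : ℝ) (L : E →L[ℝ] E) (y : E) : E :=
  (univBall (0 : E) ε).symm (tubeCoreFun hε c L (univBall (0 : E) ε y))

/-- **Off `B(0, 7/2)` the fibre map is the identity.** [folklore] -/
theorem tubeFibreFun_of_le_norm (c : ℝ) (L : E →L[ℝ] E) {y : E} (hy : 7 / 2 ≤ ‖y‖) :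
    tubeFibreFun hε c L y = y := by
  rw [tubeFibreFun, tubeCoreFun_of_le_norm hε c L (le_norm_univBall_zero hε hy)]
  exact (univBall (0 : E) ε).left_inv (by rw [univBall_source]; exact mem_univ _)

/-- **On the closed unit ball the fibre map is `(univBall 0 ε)⁻¹ (c L (univBall 0 ε y))`.** [folklore] -/
theorem tubeFibreFun_of_norm_le {c : ℝ} (hc : 0 < c) (hc1 : c ≤ 1) {L : E →L[ℝ] E}
    (hL : ‖L‖ ≤ 7 / 6) {y : E} (hy : ‖y‖ ≤ 1) :
    tubeFibreFun hε c L y = (univBall (0 : E) ε).symm (c • L (univBall (0 : E) ε y)) := by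
  rw [tubeFibreFun, tubeCoreFun_of_norm_le hε hc hc1 hL (norm_univBall_zero_le hε hy)]

/-- The fibre map fixes `0`. [folklore] -/
@[simp] theorem tubeFibreFun_apply_zero (c : ℝ) (L : E →L[ℝ] E) : tubeFibreFun hε c L 0 = 0 := by
  rw [tubeFibreFun, univBall_apply_zero, tubeCoreFun_apply_zero, univBall_symm_apply_center]

/-- **The fibre map is jointly smooth in `(L, y)`** on `{‖L - 1‖ < threshold} × E` (where the
core map keeps `B(0, ε)`, on which `(univBall 0 ε)⁻¹` is smooth). [folklore] -/
theorem contDiffOn_tubeFibreFun_uncurry (c : ℝ) :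
    ContDiffOn ℝ ∞ (fun p : (E →L[ℝ] E) × E ↦ tubeFibreFun hε c p.1 p.2)
      {p | ‖p.1 - 1‖ < straightenThreshold (coreBump (E := E))} := by
  have h1 : ContDiff ℝ ∞ fun p : (E →L[ℝ] E) × E ↦ tubeCoreFun hε c p.1 (univBall (0 : E) ε p.2) :=
    (contDiff_tubeCoreFun_uncurry hε c).comp (contDiff_fst.prodMk (contDiff_univBall.comp contDiff_snd))
  refine (contDiffOn_univBall_symm (c := (0 : E)) (r := ε)).comp h1.contDiffOn fun p hp ↦ ?_
  rw [mem_ball_zero_iff]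
  exact norm_tubeCoreFun_lt hε c hp.out.le (norm_univBall_zero_lt hε p.2)

/-- The fibre map is smooth (for `‖L - 1‖` below the threshold). [folklore] -/
theorem contDiff_tubeFibreFun (c : ℝ) {L : E →L[ℝ] E}
    (hL : ‖L - 1‖ < straightenThreshold (coreBump (E := E))) : ContDiff ℝ ∞ (tubeFibreFun hε c L) := by
  have := (contDiffOn_tubeFibreFun_uncurry hε c).comp_contDiff (contDiff_const.prodMk contDiff_id)
    (fun y ↦ by exact hL)
  exact this

/-- **The fibre map as a diffeomorphism of `E`** (inverse: the same conjugation of the inverse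
core map). [cite: GompfStipsiczGSM1999, §5.2] -/
def tubeFibreDiffeo (c : ℝ) (L : E →L[ℝ] E) (hL : ‖L - 1‖ < straightenThreshold (coreBump (E := E))) :
    E ≃ₘ⟮𝓘(ℝ, E), 𝓘(ℝ, E)⟯ E :=
  let T : E ≃ₘ⟮𝓘(ℝ, E), 𝓘(ℝ, E)⟯ E :=
    (straightenDiffeo coreBump (coreRadius_pos hε) L hL.le).trans (contractDiffeo (coreRadius_pos hε) c)
  have hT : ⇑T = tubeCoreFun hε c L := rfl
  have hTlt : ∀ y, ‖y‖ < ε → ‖T y‖ < ε := fun y hy ↦ hT ▸ norm_tubeCoreFun_lt hε c hL.le hy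
  have hTfix : ∀ y, ε * (24 / 25) ≤ ‖y‖ → T y = y := fun y hy ↦ hT ▸ tubeCoreFun_of_le_norm hε c L hy
  have hT'fix : ∀ y, ε * (24 / 25) ≤ ‖y‖ → T.symm y = y := fun y hy ↦
    T.injective (by
      show T (T.symm y) = T y
      rw [Diffeomorph.apply_symm_apply, hTfix y hy])
  have hT'lt : ∀ y, ‖y‖ < ε → ‖T.symm y‖ < ε := fun y hy ↦
    norm_lt_of_bijective_of_eq_self T.symm.bijective (fun z hz ↦ hT'fix z (by linarith)) hy
  have hsrc : ∀ y : E, y ∈ (univBall (0 : E) ε).source := fun y ↦ by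
    rw [univBall_source]; exact mem_univ _
  have htgt : ∀ y : E, ‖y‖ < ε → y ∈ (univBall (0 : E) ε).target := fun y hy ↦ by
    rw [univBall_target _ hε, mem_ball_zero_iff]; exact hy
  { toFun := tubeFibreFun hε c L
    invFun := fun y ↦ (univBall (0 : E) ε).symm (T.symm (univBall (0 : E) ε y))
    left_inv := fun y ↦ by
      show (univBall (0 : E) ε).symm (T.symm (univBall (0 : E) ε
        ((univBall (0 : E) ε).symm (T (univBall (0 : E) ε y))))) = y
      rw [(univBall (0 : E) ε).right_inv (htgt _ (hTlt _ (norm_univBall_zero_lt hε y))),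
        Diffeomorph.symm_apply_apply]
      exact (univBall (0 : E) ε).left_inv (hsrc y)
    right_inv := fun y ↦ by
      show (univBall (0 : E) ε).symm (T (univBall (0 : E) ε
        ((univBall (0 : E) ε).symm (T.symm (univBall (0 : E) ε y))))) = y
      rw [(univBall (0 : E) ε).right_inv (htgt _ (hT'lt _ (norm_univBall_zero_lt hε y))),
        Diffeomorph.apply_symm_apply]
      exact (univBall (0 : E) ε).left_inv (hsrc y)
    contMDiff_toFun := contMDiff_iff_contDiff.2 (contDiff_tubeFibreFun hε c hL)
    contMDiff_invFun := by
      refine contMDiff_iff_contDiff.2 ?_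
      have h1 : ContDiff ℝ ∞ fun y ↦ T.symm (univBall (0 : E) ε y) :=
        (contMDiff_iff_contDiff.1 T.symm.contMDiff).comp contDiff_univBall
      refine (contDiffOn_univBall_symm (c := (0 : E)) (r := ε)).comp_contDiff h1 fun y ↦ ?_
      rw [mem_ball_zero_iff]
      exact hT'lt _ (norm_univBall_zero_lt hε y) }

/-- The fibre diffeomorphism as a function (definitional). [folklore] -/
@[simp] theorem coe_tubeFibreDiffeo (c : ℝ) (L : E →L[ℝ] E)
    (hL : ‖L - 1‖ < straightenThreshold (coreBump (E := E))) :
    ⇑(tubeFibreDiffeo hε c L hL) = tubeFibreFun hε c L := rfl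

/-- **The fibre map is a bijective local diffeomorphism** (the hypotheses of
`fibrewiseDiffeomorph`). [cite: GompfStipsiczGSM1999, §5.2] -/
theorem isLocalDiffeomorph_tubeFibreFun (c : ℝ) {L : E →L[ℝ] E}
    (hL : ‖L - 1‖ < straightenThreshold (coreBump (E := E))) :
    IsLocalDiffeomorph 𝓘(ℝ, E) 𝓘(ℝ, E) ∞ (tubeFibreFun hε c L) :=
  (tubeFibreDiffeo hε c L hL).isLocalDiffeomorph

/-- The fibre map is bijective. [folklore] -/
theorem bijective_tubeFibreFun (c : ℝ) {L : E →L[ℝ] E}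
    (hL : ‖L - 1‖ < straightenThreshold (coreBump (E := E))) : Bijective (tubeFibreFun hε c L) :=
  (tubeFibreDiffeo hε c L hL).bijective

end TubeFibre

end Literature.Topology.FourManifolds
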